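import Literature.MathematicalPhysics.QuantumFieldTheory.QCDTransferMatrix
import Summits.QuantumFields.QCD.Theorems.QuarksAsStableActionStableActionBridgeShiftSubstDet

/-!
# `det (1 ⊗ P⁺ + k ⊗ P⁻) = det (k ⊗ P⁺ + 1 ⊗ P⁻) = (det k)²`
(helper for crux stmt-QuantumFields-9737 `QuarksAsStableAction.StableActionBridge`, line `Sketch`;
stubs `det_one_kronecker_projPlus_add_kronecker_projMinus` and
`det_kronecker_projPlus_add_one_kronecker_projMinus`)

In Lüscher's transfer-matrix formula for the `r = 1` Wilson fermion determinant,
`det D_W = ∏_t det E_t · det (1 − ∏_t M_t W_t)`, the chain block factorises as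
`E_t = (−W′) (P⁺ − W B̂ P⁻) (unipotent)` with a spin-blind `W B̂ = k ⊗ 1_spin` and the Wilson time
projections `P± = ½ (1 ± γ₀)` on the four-dimensional spin space.  The prefactor therefore reduces
to the determinant of `1 ⊗ P⁺ + k ⊗ P⁻` on `Z × Fin 4` (`Z` the spin-blind index), which is
`(det k) ^ rank P⁻ = (det k)²`; symmetrically
`det (k ⊗ P⁺ + 1 ⊗ P⁻) = (det k) ^ rank P⁺ = (det k)²`.

Proof.  In the tree's chiral basis `γ₀ = σʸ ⊗ σˣ`; the invertible matrix
`H = !![1, 0, 0, -I; 0, 1, -I, 0; 1, 0, 0, I; 0, 1, I, 0]` (rows: left eigenvectors of `γ₀`)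
satisfies `H P⁺ = Q⁺ H`, `H P⁻ = Q⁻ H` with the coordinate projections `Q⁺ = diag (1, 1, 0, 0)`,
`Q⁻ = diag (0, 0, 1, 1)` (landed: `ShiftSubstDet.spinH_mul_projPlus`, `spinH_mul_projMinus`,
`spinH_mul_spinHinv`).  Hence `(1 ⊗ H) (A ⊗ P⁺ + B ⊗ P⁻) = (A ⊗ Q⁺ + B ⊗ Q⁻) (1 ⊗ H)` with
`det (1 ⊗ H) ≠ 0`, so `det (A ⊗ P⁺ + B ⊗ P⁻) = det (A ⊗ Q⁺ + B ⊗ Q⁻)`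
(`ProjKroneckerDet.det_kronecker_conj_eq`); and `A ⊗ Q⁺ + B ⊗ Q⁻` is block diagonal over `Fin 4`
with blocks `A, A, B, B` (`ProjKroneckerDet.kronecker_diag_eq_blockDiagonal`), whence its
determinant is `(det A)² (det B)²` (`ProjKroneckerDet.det_kronecker_diag`).  Specialise to
`(A, B) = (1, k)` and `(k, 1)`.
[cite: Luscher1977, pp. 283–292] (prose: Smit, *Introduction to Quantum Fields on a Lattice*, §6.5).
Pure theorem file (no definitions): the auxiliary matrices are written as literals.
-/

noncomputable section

namespace Summit.QuantumFields.QCD.Cruxes.StableActionBridge.Sketch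

open scoped ComplexOrder Kronecker
open Literature.MathematicalPhysics.QuantumFieldTheory Literature.MathematicalPhysics.QuantumLattice

namespace ProjKroneckerDet

open Complex Matrix

/-- **Conjugation step.** If `H Pa = Qa H`, `H Pb = Qb H` and `H` has a right inverse, then
`det (A ⊗ Pa + B ⊗ Pb) = det (A ⊗ Qa + B ⊗ Qb)`: indeed
`(1 ⊗ H) (A ⊗ Pa + B ⊗ Pb) = (A ⊗ Qa + B ⊗ Qb) (1 ⊗ H)` with `det (1 ⊗ H) ≠ 0`. -/
theorem det_kronecker_conj_eq {m n : Type*} [Fintype m] [DecidableEq m] [Fintype n]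
    [DecidableEq n] (A B : Matrix m m ℂ) {Pa Pb Qa Qb H Hinv : Matrix n n ℂ}
    (ha : H * Pa = Qa * H) (hb : H * Pb = Qb * H) (hH : H * Hinv = 1) :
    (A ⊗ₖ Pa + B ⊗ₖ Pb).det = (A ⊗ₖ Qa + B ⊗ₖ Qb).det := by
  -- adapted from `ShiftSubstDet.det_kronecker_conj_eq` (single Kronecker factor, two blocks)
  have hUA :
      (1 : Matrix m m ℂ) ⊗ₖ H * (A ⊗ₖ Pa + B ⊗ₖ Pb) =
        (A ⊗ₖ Qa + B ⊗ₖ Qb) * (1 : Matrix m m ℂ) ⊗ₖ H := by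
    simp only [mul_add, add_mul, ← Matrix.mul_kronecker_mul, one_mul, mul_one, ha, hb]
  have hU : ((1 : Matrix m m ℂ) ⊗ₖ H).det ≠ 0 := by
    have h1 : (1 : Matrix m m ℂ) ⊗ₖ H * (1 : Matrix m m ℂ) ⊗ₖ Hinv = 1 := by
      simp only [← Matrix.mul_kronecker_mul, one_mul, hH, Matrix.one_kronecker_one]
    have h2 := congrArg Matrix.det h1
    rw [Matrix.det_mul, Matrix.det_one] at h2
    exact left_ne_zero_of_mul_eq_one h2
  have h := congrArg Matrix.det hUA
  rw [Matrix.det_mul, Matrix.det_mul, mul_comm _ (Matrix.det ((1 : Matrix m m ℂ) ⊗ₖ H))] at h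
  exact mul_left_cancel₀ hU h

/-- **Block structure.** With the coordinate projections `Q⁺ = diag (1, 1, 0, 0)`,
`Q⁻ = diag (0, 0, 1, 1)` the matrix `A ⊗ Q⁺ + B ⊗ Q⁻` on `m × Fin 4` is block diagonal over the
spin index with blocks `A, A, B, B`. -/
theorem kronecker_diag_eq_blockDiagonal {m : Type*} (A B : Matrix m m ℂ) :
    A ⊗ₖ (!![1, 0, 0, 0; 0, 1, 0, 0; 0, 0, 0, 0; 0, 0, 0, 0] : Matrix (Fin 4) (Fin 4) ℂ) +
        B ⊗ₖ (!![0, 0, 0, 0; 0, 0, 0, 0; 0, 0, 1, 0; 0, 0, 0, 1] : Matrix (Fin 4) (Fin 4) ℂ) =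
      Matrix.blockDiagonal fun α : Fin 4 => if α = 0 ∨ α = 1 then A else B := by
  ext ⟨x, α⟩ ⟨y, β⟩
  simp only [Matrix.add_apply, Matrix.kroneckerMap_apply, Matrix.blockDiagonal_apply]
  fin_cases α <;> fin_cases β <;> simp

/-- **Block step.** `det (A ⊗ Q⁺ + B ⊗ Q⁻) = (det A)² (det B)²` for the coordinate projections
`Q⁺ = diag (1, 1, 0, 0)`, `Q⁻ = diag (0, 0, 1, 1)`. -/
theorem det_kronecker_diag {m : Type*} [Fintype m] [DecidableEq m] (A B : Matrix m m ℂ) :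
    (A ⊗ₖ (!![1, 0, 0, 0; 0, 1, 0, 0; 0, 0, 0, 0; 0, 0, 0, 0] : Matrix (Fin 4) (Fin 4) ℂ) +
        B ⊗ₖ (!![0, 0, 0, 0; 0, 0, 0, 0; 0, 0, 1, 0; 0, 0, 0, 1] : Matrix (Fin 4) (Fin 4) ℂ)).det =
      A.det ^ 2 * B.det ^ 2 := by
  rw [kronecker_diag_eq_blockDiagonal, Matrix.det_blockDiagonal, Fin.prod_univ_four]
  simp only [Fin.isValue, true_or, or_true, if_true, Fin.reduceEq, or_self, if_false]
  ring

end ProjKroneckerDet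

/-- **`det (1 ⊗ P⁺ + k ⊗ P⁻) = (det k)²`**
(stub `det_one_kronecker_projPlus_add_kronecker_projMinus` of line `Sketch`): for the Wilson time
projections `P± = ½ (1 ± γ₀)` on the four-dimensional spin space and any square matrix `k` on a
finite index type `Z`, the matrix `1 ⊗ P⁺ + k ⊗ P⁻` on `Z × Fin 4` has determinant
`(det k) ^ rank P⁻ = (det k)²`. -/
theorem det_one_kronecker_projPlus_add_kronecker_projMinus :
    ∀ (Z : Type) [Fintype Z] [DecidableEq Z] (k : Matrix Z Z ℂ),
      ((1 : Matrix Z Z ℂ) ⊗ₖ ((1 / 2 : ℂ) • ((1 : Matrix (Fin 4) (Fin 4) ℂ) + euclideanGamma 0)) +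
          k ⊗ₖ ((1 / 2 : ℂ) • ((1 : Matrix (Fin 4) (Fin 4) ℂ) - euclideanGamma 0))).det = k.det ^ 2 := by
  intro Z _ _ k
  rw [ProjKroneckerDet.det_kronecker_conj_eq _ _ ShiftSubstDet.spinH_mul_projPlus
      ShiftSubstDet.spinH_mul_projMinus ShiftSubstDet.spinH_mul_spinHinv,
    ProjKroneckerDet.det_kronecker_diag, Matrix.det_one, one_pow, one_mul]

/-- **`det (k ⊗ P⁺ + 1 ⊗ P⁻) = (det k)²`**
(stub `det_kronecker_projPlus_add_one_kronecker_projMinus` of line `Sketch`): for the Wilson time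
projections `P± = ½ (1 ± γ₀)` on the four-dimensional spin space and any square matrix `k` on a
finite index type `Z`, the matrix `k ⊗ P⁺ + 1 ⊗ P⁻` on `Z × Fin 4` has determinant
`(det k) ^ rank P⁺ = (det k)²`. -/
theorem det_kronecker_projPlus_add_one_kronecker_projMinus :
    ∀ (Z : Type) [Fintype Z] [DecidableEq Z] (k : Matrix Z Z ℂ),
      (k ⊗ₖ ((1 / 2 : ℂ) • ((1 : Matrix (Fin 4) (Fin 4) ℂ) + euclideanGamma 0)) +
          (1 : Matrix Z Z ℂ) ⊗ₖ ((1 / 2 : ℂ) • ((1 : Matrix (Fin 4) (Fin 4) ℂ) - euclideanGamma 0))).det = k.det ^ 2 := by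
  intro Z _ _ k
  rw [ProjKroneckerDet.det_kronecker_conj_eq _ _ ShiftSubstDet.spinH_mul_projPlus
      ShiftSubstDet.spinH_mul_projMinus ShiftSubstDet.spinH_mul_spinHinv,
    ProjKroneckerDet.det_kronecker_diag, Matrix.det_one, one_pow, mul_one]

end Summit.QuantumFields.QCD.Cruxes.StableActionBridge.Sketch

end
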